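import Summits.QuantumAdvantage.AdviceFreeQNC0.AffBells23AntipodalCount
import Summits.QuantumAdvantage.AdviceFreeQNC0.AffBells23AntipodalSmall
import HarnessLib

/-!
# The antipodal 2-junta, corollary of ask P-23h: **`antipodalLeThreeQuartersFrom8 : AntipodalLeThreeQuartersFrom8`** — the
# antipodal strategy wins at most `3/4` of the odd inputs for every even `N ≥ 8`

From the closed form `4·wins(N) = 2^N + a_{N/2} − (−2)^{N/2} − b_{N/2}` (`antipodal_value`, `AffBells23AntipodalCount.lean`) and the
growth of the Lucas-type sequences: `b_h ≥ 0`, `a_h > 0`, `a_{h+1} ≤ 5a_h`, `10a_h ≤ 3a_{h+1}`, hence `5a_{h+2} ≤ 18a_{h+1}` (ratio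
`< 3.6 < 4`), so `2a_h + 2·2^h ≤ 4^h` for `h ≥ 8` by induction (`two_luc32_le`), while `h = 4, 5, 6, 7` are checked from the values
(`192 ≤ 256`, `1008 ≤ 1024`, `3360 ≤ 4096`, `13392 ≤ 16384`).  So `2(a_h − (−2)^h − b_h) ≤ 4^h` for `h ≥ 4`, i.e. `4·wins ≤ 3·2^{N−1}`.
(The typed `AntipodalLeThreeQuarters`, from `N = 6`, is false: `not_antipodalLeThreeQuarters`, `AffBells23AntipodalSmall.lean`.)
WHAT THIS IS NOT: instrument for crux stmt-QuantumAdvantage-22907 (route DWalkThree); separation NOT moved.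
-/

namespace Summit.QuantumAdvantage.AdviceFreeQNC0

namespace AffBells23

/-! ### Growth of the Lucas-type sequences -/

/-- `b_h > 0`. -/
theorem luc14_pos : ∀ h : ℕ, 0 < luc14 h
  | 0 => by decide
  | 1 => by decide
  | h + 2 => by
      rw [luc14]
      have h1 := luc14_pos (h + 1)
      have h0 := luc14_pos h
      linarith

/-- `a_h > 0`. -/
theorem luc32_pos : ∀ h : ℕ, 0 < luc32 h
  | 0 => by decide
  | 1 => by decide
  | h + 2 => by
      rw [luc32]
      have h1 := luc32_pos (h + 1)
      have h0 := luc32_pos h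
      linarith

/-- `a_h ≤ a_{h+1}`. -/
theorem luc32_mono : ∀ h : ℕ, luc32 h ≤ luc32 (h + 1)
  | 0 => by decide
  | h + 1 => by
      have e : luc32 (h + 1 + 1) = 3 * luc32 (h + 1) + 2 * luc32 h := luc32_rec h
      have h0 := luc32_pos h
      have h1 := luc32_pos (h + 1)
      linarith

/-- `a_{h+2} ≤ 5a_{h+1}`. -/
theorem luc32_le_five (h : ℕ) : luc32 (h + 2) ≤ 5 * luc32 (h + 1) := by
  have e : luc32 (h + 2) = 3 * luc32 (h + 1) + 2 * luc32 h := luc32_rec h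
  have := luc32_mono h
  linarith

/-- `10a_{h+1} ≤ 3a_{h+2}`. -/
theorem ten_luc32_le : ∀ h : ℕ, 10 * luc32 (h + 1) ≤ 3 * luc32 (h + 2)
  | 0 => by decide
  | h + 1 => by
      have e : luc32 (h + 1 + 2) = 3 * luc32 (h + 1 + 1) + 2 * luc32 (h + 1) := luc32_rec (h + 1)
      have h5 : luc32 (h + 1 + 1) ≤ 5 * luc32 (h + 1) := luc32_le_five h
      have hp := luc32_pos (h + 1)
      linarith

/-- `5a_{h+3} ≤ 18a_{h+2}` (growth ratio below `3.6`). -/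
theorem five_luc32_le (h : ℕ) : 5 * luc32 (h + 3) ≤ 18 * luc32 (h + 2) := by
  have e : luc32 (h + 3) = 3 * luc32 (h + 2) + 2 * luc32 (h + 1) := luc32_rec (h + 1)
  have := ten_luc32_le h
  linarith

/-- **`2a_h + 2·2^h ≤ 4^h` for `h ≥ 8`.** -/
theorem two_luc32_le : ∀ h : ℕ, 8 ≤ h → 2 * luc32 h + 2 * 2 ^ h ≤ (4 : ℤ) ^ h := by
  intro h hh
  induction h with
  | zero => omega
  | succ k ih =>
    rcases Nat.lt_or_ge k 8 with hk | hk
    · have hk8 : k = 7 := by omega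
      subst hk8
      decide
    · have ihk := ih hk
      have hg : 5 * luc32 (k + 1) ≤ 18 * luc32 k := by
        obtain ⟨j, rfl⟩ : ∃ j, k = j + 2 := ⟨k - 2, by omega⟩
        exact five_luc32_le j
      have h2 : (0 : ℤ) ≤ 2 ^ k := by positivity
      have h4 : (0 : ℤ) ≤ 4 ^ k := by positivity
      have e4 : (4 : ℤ) ^ (k + 1) = 4 * 4 ^ k := by ring
      have e2 : (2 : ℤ) ^ (k + 1) = 2 * 2 ^ k := by ring
      rw [e4, e2]
      linarith

/-- **The excess is at most half**: `2(a_h − (−2)^h − b_h) ≤ 4^h` for every `h ≥ 4`. -/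
theorem excess_le (h : ℕ) (hh : 4 ≤ h) : 2 * (luc32 h - (-2) ^ h - luc14 h) ≤ (4 : ℤ) ^ h := by
  rcases Nat.lt_or_ge h 8 with hlt | hge
  · interval_cases h <;> decide
  · have h1 := two_luc32_le h hge
    have h2 := luc14_pos h
    have h3 : -((-2 : ℤ) ^ h) ≤ 2 ^ h := by
      rcases Nat.even_or_odd h with he | ho
      · rw [he.neg_pow]; have : (0 : ℤ) ≤ 2 ^ h := by positivity
        linarith
      · rw [ho.neg_pow]; linarith
    linarith

/-- **`AntipodalLeThreeQuartersFrom8` — PROVED**: for every even `N ≥ 8` the antipodal strategy wins on at most `(3/4)·2^{N−1}` odd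
inputs. -/
theorem antipodalLeThreeQuartersFrom8 : AntipodalLeThreeQuartersFrom8 := by
  intro N h8 heven
  obtain ⟨n, rfl⟩ : ∃ n, N = (n + 2) + (n + 2) := ⟨N / 2 - 2, by omega⟩
  have hval := antipodal_value n
  have hex := excess_le (n + 2) (by omega)
  have hpow : (4 : ℤ) ^ (n + 2) = 2 * 2 ^ ((n + 2) + (n + 2) - 1) := by
    rw [show (4 : ℤ) = 2 ^ 2 by norm_num, ← pow_mul,
      show 2 * (n + 2) = ((n + 2) + (n + 2) - 1) + 1 by omega, pow_succ]
    ring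
  have key : (4 * (affWinCard (antipodalRows ((n + 2) + (n + 2))) (fun _ => (1 : ZMod 3)) : ℤ)) ≤
      3 * 2 ^ ((n + 2) + (n + 2) - 1) := by
    linarith
  exact_mod_cast key

end AffBells23

end Summit.QuantumAdvantage.AdviceFreeQNC0
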